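import Summits.BirchSwinnertonDyer.BirchSwinnertonDyer.Theorems.AdditiveKolyvaginRoadRamifiedHabitatPStarTwistSign
import Literature.NumberTheory.EllipticCurves.CuspFormTwistAtkinLehnerCoprimeProofs
import HarnessLib

/-!
# Route `AdditiveKolyvaginRoad`, crux KS′ `LevelKolyvaginSystemsAdditive` (stmt-BirchSwinnertonDyer-21396), card `ramified-toric-habitat` —
# the `p*`-TWIST SIGN RATIO `w(E)·w(E^{(p*)})` at an additive prime `p` for an ARBITRARY cofactor `M = N/p²`

Cell `pub/bsd-wall`, width seat `bsd-wall-akr-p2x-w2` g12; `--supports stmt-BirchSwinnertonDyer-21396` (helper). THEOREMS ONLY; no definition,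
no named fact, no `sorry`. BSD is not proved by any of this; KS′/KPA′ stay OPEN at `p² ∣ N`.

Part 2 of the w2 g11 series (`…RamifiedHabitatPStarTwistSign`, p650808) proves `w(E)·w(E') = (M/p)·λ_p(f)·λ_p(f')` for
`E' = E^{(p*)}` ONLY when `M = N/p²` is SQUAREFREE (`E` semistable away from `p`): there the Atkin–Lehner eigenvalues at `q ∣ M`
are read off the Fourier coefficients, `λ_q = −a_q` (`q ∥ N`). At a second ADDITIVE prime `q ≠ p` (`q² ∣ M`) this is impossible
(`a_q = 0`). Here the restriction is REMOVED: by the `q`-expansion principle the newform `f` of `E` IS the quadratic twist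
`(f')_χ`, `χ = (·/p)`, of the newform `f'` of `E'` (`cuspCoeff_eq_legendreSym_mul_cuspCoeff`, `cuspCoeff_charTwist`), and the
Atkin–Lehner involution `w_{Q_q}` at an exact divisor prime to `p` commutes with the twist up to `χ(Q_q)`
(`atkinLehnerEigenvalueAt_charTwist_of_coprime`, `Literature/…/CuspFormTwistAtkinLehnerCoprimeProofs`, Atkin–Li 1978 /
Shemanske–Walling 1993 Prop. 5.4 — PROVED in the tree), so `λ_q(f) = (q/p)^{v_q(N)}·λ_q(f')` at EVERY `q ∣ M` and
`∏_{q ∣ M} (q/p)^{v_q(N)} = (M/p)`.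

* §1 `atkinLehnerEigenvalueAt_mul_pStarTwist_eq_legendreSym_pow` — `λ_q(f)·λ_q(f') = (q^{v_q(N)}/p)` at every prime `q ∣ M`.
* §2 `rootNumber_mul_rootNumber_pStarTwist_eq_legendreSym_mul_anyLevel` — **`w(E)·w(E') = (M/p)·λ_p(f)·λ_p(f')` for EVERY `M`
  prime to `p`** (from `IsNewformOf` data alone; the two eigenvalues AT `p` stay symbolic, as in part 2).
* §3 `rootNumber_mul_rootNumber_pStarTwist_anyLevel` — explicit, modulo the Modularity Theorem (`exists_isNewformOf`) and
  Kellock–Dokchitser's Rem. 2.2 at `p` for `E`, `E'` (named fact `atkinLehnerEigenvalueAt_eq_localRootNumberAt`): for `ord_p Δ_min =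
  a ∈ {2,3,4}`, `ord_p c₄ > 0`, `3 ord_p c₄ ≥ ord_p Δ` (types II/III/IV): `w(E)·w(E') = (M/p)·(3/p)` (`a ∈ {2,4}`), `= (M/p)` (`a = 3`) —
  part 2's §4 VERBATIM without `Squarefree M`, i.e. for `E` with ARBITRARY reduction at the primes `q ≠ p` (other additive primes
  allowed; this is what the LOW₀ rows `E^{(d_K)}` of the crux need, being additive at every prime of `d_K`).

References: [cite: ShemanskeWalling1993, Prop. 5.4] [cite: AtkinLi1978, §3] [cite: Knapp1993, Thm. 9.27]
[cite: Rohrlich1993Compositio, Prop. 2(iv)] [cite: KellockDokchitser2023, Rem. 2.2].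
-/

set_option autoImplicit false
set_option linter.dupNamespace false

noncomputable section

open scoped Classical MatrixGroups

open CongruenceSubgroup IsDedekindDomain IsDedekindDomain.HeightOneSpectrum NumberField Rat.HeightOneSpectrum
  WeierstrassCurve Literature.NumberTheory.EllipticCurves Literature.NumberTheory.EllipticCurves.ModularForms
  IsDiscreteValuationRing

namespace Summit.BirchSwinnertonDyer.BirchSwinnertonDyer.Theorems.AdditiveKoly.RamifiedHabitat

/-! ## §1 `λ_q(f)·λ_q(f') = (q^{v_q(N)}/p)` at every prime `q ∣ M`, and §2 the modular assembly for arbitrary `M` -/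

section Modular

variable {p : ℕ} [Fact p.Prime]

/-- **`λ_q(f)·λ_q(f') = (q^{v_q(N)} / p)` at every prime `q ≠ p` of the common level.** `W/ℚ` elliptic of conductor `N = M·p²`,
`p` odd, `p ∤ M`; `W' = W^{(p*)}` elliptic of the SAME conductor; `f, f'` their newforms. Since `p² ∣ N`, `W` is additive at `p`,
so `aₙ(f) = (n/p)·aₙ(f')` for all `n` (`cuspCoeff_eq_legendreSym_mul_cuspCoeff`) and `f = (f')_χ`, `χ = (·/p)`, by the
`q`-expansion principle; then `λ_q(f) = χ(q^{v_q(N)})·λ_q(f')` (`atkinLehnerEigenvalueAt_charTwist_of_coprime`, Atkin–Li /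
Shemanske–Walling Prop. 5.4) and `λ_q(f')² = 1` (Knapp Thm. 9.27(b)). [cite: ShemanskeWalling1993, Prop. 5.4] [cite: Knapp1993, Thm. 9.27] -/
theorem atkinLehnerEigenvalueAt_mul_pStarTwist_eq_legendreSym_pow (W : WeierstrassCurve ℚ) [W.IsElliptic]
    [NeZero (W.conductorNorm ℤ)] (hp2 : p ≠ 2) {M : ℕ} (hN : W.conductorNorm ℤ = M * p ^ 2) (hpM : ¬ p ∣ M)
    [(W.quadraticTwist (((-1 : ℤ) ^ (p / 2) * p : ℤ) : ℚ)).IsElliptic]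
    [NeZero ((W.quadraticTwist (((-1 : ℤ) ^ (p / 2) * p : ℤ) : ℚ)).conductorNorm ℤ)]
    (hN' : (W.quadraticTwist (((-1 : ℤ) ^ (p / 2) * p : ℤ) : ℚ)).conductorNorm ℤ = M * p ^ 2)
    {f : CuspForm (Gamma0 (W.conductorNorm ℤ)) 2} (hf : IsNewformOf W f)
    {f' : CuspForm (Gamma0 ((W.quadraticTwist (((-1 : ℤ) ^ (p / 2) * p : ℤ) : ℚ)).conductorNorm ℤ)) 2}
    (hf' : IsNewformOf (W.quadraticTwist (((-1 : ℤ) ^ (p / 2) * p : ℤ) : ℚ)) f') {q : ℕ} (hq : q ∈ M.primeFactors) :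
    atkinLehnerEigenvalueAt f q * atkinLehnerEigenvalueAt f' q = legendreSym p (q ^ (W.conductorNorm ℤ).factorization q : ℕ) := by
  have hp : p.Prime := Fact.out
  have hM0 : M ≠ 0 := fun h ↦ NeZero.ne (W.conductorNorm ℤ) (by rw [hN, h, zero_mul])
  have hqP : q.Prime := Nat.prime_of_mem_primeFactors hq
  have hqM : q ∣ M := Nat.dvd_of_mem_primeFactors hq
  have hqp : q ≠ p := by rintro rfl; exact hpM hqM
  -- levels: `N' ∣ N`, `p² ∣ N`, equal factorizations, `q ∣ N`, `q ∣ N'`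
  have hN'N : (W.quadraticTwist (((-1 : ℤ) ^ (p / 2) * p : ℤ) : ℚ)).conductorNorm ℤ ∣ W.conductorNorm ℤ := by
    rw [hN', hN]
  have hpN : p ^ 2 ∣ W.conductorNorm ℤ := hN ▸ Dvd.intro_left M rfl
  have hqN : q ∈ (W.conductorNorm ℤ).primeFactors :=
    Nat.mem_primeFactors.mpr ⟨hqP, hN ▸ hqM.mul_right _, NeZero.ne _⟩
  have hqN' : q ∣ (W.quadraticTwist (((-1 : ℤ) ^ (p / 2) * p : ℤ) : ℚ)).conductorNorm ℤ := hN' ▸ hqM.mul_right _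
  have hv : ((W.quadraticTwist (((-1 : ℤ) ^ (p / 2) * p : ℤ) : ℚ)).conductorNorm ℤ).factorization q =
      (W.conductorNorm ℤ).factorization q := by rw [hN', hN]
  -- `W` is additive at `p` (`p² ∣ N`)
  set P : Nat.Primes := ⟨p, hp⟩ with hP
  have hgen : natGenerator ((primesEquiv (R := ℤ)).symm P) = p :=
    congrArg (fun r : Nat.Primes ↦ (r : ℕ)) ((primesEquiv (R := ℤ)).apply_symm_apply P)
  have h2 : 2 ≤ W.conductorExponent ((primesEquiv (R := ℤ)).symm P) := by
    rw [← factorization_conductorNorm_holds W ((primesEquiv (R := ℤ)).symm P), hgen]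
    exact (hp.pow_dvd_iff_le_factorization (NeZero.ne _)).mp hpN
  have hadd : W.HasAdditiveReductionAt ((primesEquiv (R := ℤ)).symm P) := (two_le_conductorExponent_iff_holds _ W).mp h2
  set v : HeightOneSpectrum (𝓞 ℚ) := (primesEquiv (R := 𝓞 ℚ)).symm P with hvdef
  have hvp : (primesEquiv v : ℕ) = p := by rw [hvdef, Equiv.apply_symm_apply]
  have haddO : W.HasAdditiveReductionAt v := (W.hasAdditiveReductionAt_int_iff_ringOfIntegers P).mp hadd
  -- `f = (f')_χ`, `χ = (·/p)`
  set χ : DirichletCharacter ℂ p := (quadraticChar (ZMod p)).ringHomComp (Int.castRingHom ℂ) with hχ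
  have hquad := isQuadratic_quadraticChar_ringHomComp p
  have hprim := isPrimitive_quadraticChar_ringHomComp p hp2
  have hcoeff : ∀ n : ℕ, cuspCoeff f n = (legendreSym p n : ℂ) * cuspCoeff f' n :=
    W.cuspCoeff_eq_legendreSym_mul_cuspCoeff hp2 hvp haddO hf hf'
  have hfeq : f = charTwist (W.conductorNorm ℤ) hN'N hpN hquad f' := by
    refine eq_of_forall_cuspCoeff_eq_gamma0 fun n ↦ ?_
    rw [cuspCoeff_charTwist _ hN'N hpN hquad hprim f' n, hcoeff n, ← hχ, quadraticChar_ringHomComp_apply_natCast]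
  have hf0 : f ≠ 0 := fun h0 ↦ hf.1.coe_ne_zero (by rw [h0]; rfl)
  -- `w_{Q_q} f' = λ_q(f') f'` and the commutation rule
  have hε' := hf'.1.atkinLehnerInvolutionAt_eq_atkinLehnerEigenvalueAt_smul hqP hqN'
  have hne : charTwist (W.conductorNorm ℤ) hN'N hpN hquad f' ≠ 0 := hfeq ▸ hf0
  have hlam : atkinLehnerEigenvalueAt f q =
      χ (q ^ (W.conductorNorm ℤ).factorization q : ℕ) * atkinLehnerEigenvalueAt f' q := by
    conv_lhs => rw [hfeq]
    exact atkinLehnerEigenvalueAt_charTwist_of_coprime (W.conductorNorm ℤ) hN'N hpN hqN hqp hv hquad hε' hne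
  have hsq : atkinLehnerEigenvalueAt f' q * atkinLehnerEigenvalueAt f' q = 1 := by
    rcases hf'.1.atkinLehnerEigenvalueAt_eq_one_or_eq_neg_one hqP hqN' with h | h <;> rw [h] <;> norm_num
  rw [hlam, hχ, quadraticChar_ringHomComp_apply_natCast, mul_assoc, hsq, mul_one]

/-- **`w(E)·w(E') = (M/p)·λ_p(f)·λ_p(f')` — the `p*`-twist sign ratio is Atkin–Lehner-formal off `p`, for EVERY cofactor `M`.**
`W/ℚ` elliptic of conductor `N = M·p²` with `p ∤ M` (`p` an odd prime; NO squarefree hypothesis on `M`), `W' = W^{(p*)}` elliptic of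
the SAME conductor, `f, f'` their newforms (`IsNewformOf`). Then `w(W) = −ε(f) = −∏_{q ∣ N} λ_q(f)` (Hecke + Atkin–Lehner, Knapp
Thm. 9.27(c)), likewise for `W'`; §1 gives `λ_q(f)λ_q(f') = (q^{v_q(N)}/p)` at `q ∣ M`, and `∏_{q ∣ M} (q^{v_q(N)}/p) = (M/p)`
(`M = ∏ q^{v_q(M)}`, `v_q(N) = v_q(M)`). Part 2's `…_eq_legendreSym_mul` is the case `M` squarefree. No local-global input is used:
the two eigenvalues AT `p` stay symbolic. [cite: Knapp1993, Thm. 9.27] [cite: ShemanskeWalling1993, Prop. 5.4] [cite: AtkinLi1978, §3] -/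
theorem rootNumber_mul_rootNumber_pStarTwist_eq_legendreSym_mul_anyLevel (W : WeierstrassCurve ℚ) [W.IsElliptic]
    [NeZero (W.conductorNorm ℤ)] (hp2 : p ≠ 2) {M : ℕ} (hN : W.conductorNorm ℤ = M * p ^ 2) (hpM : ¬ p ∣ M)
    [(W.quadraticTwist (((-1 : ℤ) ^ (p / 2) * p : ℤ) : ℚ)).IsElliptic]
    [NeZero ((W.quadraticTwist (((-1 : ℤ) ^ (p / 2) * p : ℤ) : ℚ)).conductorNorm ℤ)]
    (hN' : (W.quadraticTwist (((-1 : ℤ) ^ (p / 2) * p : ℤ) : ℚ)).conductorNorm ℤ = M * p ^ 2)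
    {f : CuspForm (Gamma0 (W.conductorNorm ℤ)) 2} (hf : IsNewformOf W f)
    {f' : CuspForm (Gamma0 ((W.quadraticTwist (((-1 : ℤ) ^ (p / 2) * p : ℤ) : ℚ)).conductorNorm ℤ)) 2}
    (hf' : IsNewformOf (W.quadraticTwist (((-1 : ℤ) ^ (p / 2) * p : ℤ) : ℚ)) f') :
    ((W.rootNumber * (W.quadraticTwist (((-1 : ℤ) ^ (p / 2) * p : ℤ) : ℚ)).rootNumber : ℤ) : ℂ) =
      legendreSym p M * (atkinLehnerEigenvalueAt f p * atkinLehnerEigenvalueAt f' p) := by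
  have hp : p.Prime := Fact.out
  -- `w = -ε(f) = -∏ λ_q(f)` for both curves
  have hw : (W.rootNumber : ℂ) = -frickeEigenvalue f :=
    Literature.NumberTheory.EllipticCurves.rootNumber_eq_neg_of_frickeInvolution_eq_smul W hf
      (IsNewform0.frickeEigenvalue_eq_one_or_eq_neg_one_holds hf.1) (IsNewform0.frickeInvolution_eq_smul_holds hf.1)
  have hw' : ((W.quadraticTwist (((-1 : ℤ) ^ (p / 2) * p : ℤ) : ℚ)).rootNumber : ℂ) = -frickeEigenvalue f' :=
    Literature.NumberTheory.EllipticCurves.rootNumber_eq_neg_of_frickeInvolution_eq_smul _ hf'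
      (IsNewform0.frickeEigenvalue_eq_one_or_eq_neg_one_holds hf'.1) (IsNewform0.frickeInvolution_eq_smul_holds hf'.1)
  have hε := IsNewform0.frickeEigenvalue_eq_prod_atkinLehnerEigenvalueAt_holds hf.1
  have hε' := IsNewform0.frickeEigenvalue_eq_prod_atkinLehnerEigenvalueAt_holds hf'.1
  -- the prime factors of the common level `M p²`
  have hM0 : M ≠ 0 := fun h ↦ NeZero.ne (W.conductorNorm ℤ) (by rw [hN, h, zero_mul])
  have hpf0 : (M * p ^ 2).primeFactors = insert p M.primeFactors := by
    rw [Nat.primeFactors_mul hM0 (pow_ne_zero 2 hp.ne_zero), Nat.primeFactors_pow _ two_ne_zero,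
      hp.primeFactors, Finset.union_comm]
    rfl
  have hpf : (W.conductorNorm ℤ).primeFactors = insert p M.primeFactors := by rw [hN, hpf0]
  have hpf' : ((W.quadraticTwist (((-1 : ℤ) ^ (p / 2) * p : ℤ) : ℚ)).conductorNorm ℤ).primeFactors =
      insert p M.primeFactors := by rw [hN', hpf0]
  have hpnot : p ∉ M.primeFactors := fun h ↦ hpM (Nat.dvd_of_mem_primeFactors h)
  -- at `q ∣ M`: `λ_q(f) λ_q(f') = (q^{v_q(N)}/p)` (§1)
  have hq : ∀ q ∈ M.primeFactors, atkinLehnerEigenvalueAt f q * atkinLehnerEigenvalueAt f' q =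
      legendreSym p (q ^ (W.conductorNorm ℤ).factorization q : ℕ) := fun q hqM ↦
    atkinLehnerEigenvalueAt_mul_pStarTwist_eq_legendreSym_pow W hp2 hN hpM hN' hf hf' hqM
  -- `∏_{q ∣ M} (q^{v_q(N)}/p) = (M/p)`
  have hfac : ∀ q ∈ M.primeFactors, (W.conductorNorm ℤ).factorization q = M.factorization q := by
    intro q hqM
    have hqp : q ≠ p := fun h ↦ hpnot (h ▸ hqM)
    rw [hN, Nat.factorization_mul hM0 (pow_ne_zero 2 hp.ne_zero), Finsupp.add_apply, hp.factorization_pow,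
      Finsupp.single_apply, if_neg (Ne.symm hqp), add_zero]
  have hleg : ∏ q ∈ M.primeFactors, (legendreSym p (q ^ (W.conductorNorm ℤ).factorization q : ℕ) : ℂ) = legendreSym p M := by
    conv_rhs => rw [Nat.prod_primeFactors_pow_factorization hM0]
    rw [Nat.cast_prod, ← legendreSym.hom_apply, map_prod]
    push_cast
    refine Finset.prod_congr rfl fun q hqM ↦ ?_
    rw [legendreSym.hom_apply, hfac q hqM]
  -- assemble
  rw [Int.cast_mul, hw, hw', hε, hε', hpf, hpf', Finset.prod_insert hpnot, Finset.prod_insert hpnot, neg_mul_neg,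
    mul_mul_mul_comm, ← Finset.prod_mul_distrib, Finset.prod_congr rfl hq, hleg]
  ring

end Modular

/-! ## §3 The `p*`-twist sign ratio, explicit, modulo the Modularity Theorem and Kellock–Dokchitser's Remark 2.2 at `p` -/

section Main

variable {p : ℕ} [Fact p.Prime]

/-- **THE `p*`-TWIST SIGN RATIO AT AN ADDITIVE POTENTIALLY GOOD PRIME (types II, III, IV), ARBITRARY REDUCTION ELSEWHERE.** Let `W/ℚ`
be elliptic of conductor `N = M·p²`, `p ≥ 5`, `p ∤ M` (NO squarefree hypothesis: `W` may have further additive primes), whose minimal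
model at `p` has `ord_p Δ = a ∈ {2, 3, 4}`, `ord_p c₄ > 0` and `3·ord_p c₄ ≥ ord_p Δ` (additive, potentially good: `e = 6, 4, 3`),
and let `W' = W^{(p*)}`, `p* = (−1)^{(p−1)/2} p`. ASSUMING the Modularity Theorem (`exists_isNewformOf`) and Kellock–Dokchitser's
Remark 2.2 `λ(Q_p) = W_p` for `W` and for `W'` (the named fact `atkinLehnerEigenvalueAt_eq_localRootNumberAt`, used only AT `p`):
`w(W)·w(W') = (M/p)·W_p(W)·W_p(W') = (M/p)·(3/p)` if `a ∈ {2, 4}`, `= (M/p)` if `a = 3` (§2 + part 1's local computation at `p`,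
`localRootNumber_mul_pStarTwist_padic`; Rohrlich Prop. 2(iv)). CONDITIONAL on the two named facts; nothing else is assumed.
[cite: Rohrlich1993Compositio, Prop. 2(iv)] [cite: KellockDokchitser2023, Rem. 2.2] [cite: Knapp1993, Thm. 9.27] [cite: ShemanskeWalling1993, Prop. 5.4] -/
theorem rootNumber_mul_rootNumber_pStarTwist_anyLevel (W : WeierstrassCurve ℚ) [W.IsElliptic] (hmod : exists_isNewformOf)
    (hF1 : W.atkinLehnerEigenvalueAt_eq_localRootNumberAt)
    (hF1' : (W.quadraticTwist (((-1 : ℤ) ^ (p / 2) * p : ℤ) : ℚ)).atkinLehnerEigenvalueAt_eq_localRootNumberAt)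
    (hp5 : 5 ≤ p) {M : ℕ} (hN : W.conductorNorm ℤ = M * p ^ 2) (hpM : ¬ p ∣ M) {a : ℕ}
    (hΔ : addVal ℤ_[p] (((W.baseChange ℚ_[p]).minimal ℤ_[p]).integralModel ℤ_[p]).Δ = a)
    (ha : a = 2 ∨ a = 3 ∨ a = 4)
    (hc₄ : addVal ℤ_[p] (((W.baseChange ℚ_[p]).minimal ℤ_[p]).integralModel ℤ_[p]).c₄ ≠ 0)
    (hj : ¬ 3 * addVal ℤ_[p] (((W.baseChange ℚ_[p]).minimal ℤ_[p]).integralModel ℤ_[p]).c₄ <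
      addVal ℤ_[p] (((W.baseChange ℚ_[p]).minimal ℤ_[p]).integralModel ℤ_[p]).Δ) :
    W.rootNumber * (W.quadraticTwist (((-1 : ℤ) ^ (p / 2) * p : ℤ) : ℚ)).rootNumber =
      legendreSym p M * (if a = 3 then 1 else ZMod.χ₄ p * (if p % 3 = 1 then 1 else -1)) := by
  have hp : p.Prime := Fact.out
  have hp2 : p ≠ 2 := by omega
  have hdZ0 : ((-1 : ℤ) ^ (p / 2) * p : ℤ) ≠ 0 :=
    mul_ne_zero (pow_ne_zero _ (by norm_num)) (by exact_mod_cast hp.ne_zero)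
  have hd0 : (((((-1 : ℤ) ^ (p / 2) * p : ℤ)) : ℚ)) ≠ 0 := by exact_mod_cast hdZ0
  haveI hE' : (W.quadraticTwist (((-1 : ℤ) ^ (p / 2) * p : ℤ) : ℚ)).IsElliptic := W.isElliptic_quadraticTwist hd0
  haveI : NeZero (W.conductorNorm ℤ) := ⟨(W.conductorNorm_pos_holds).ne'⟩
  haveI : NeZero ((W.quadraticTwist (((-1 : ℤ) ^ (p / 2) * p : ℤ) : ℚ)).conductorNorm ℤ) :=
    ⟨((W.quadraticTwist _).conductorNorm_pos_holds).ne'⟩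
  -- part 1: the local data at `p`; the conductor of the twist
  obtain ⟨hadd, hadd', hprod⟩ := localRootNumber_mul_pStarTwist_padic W hp5 hΔ ha hc₄ hj
  have hN' : (W.quadraticTwist (((-1 : ℤ) ^ (p / 2) * p : ℤ) : ℚ)).conductorNorm ℤ = M * p ^ 2 :=
    (conductorNorm_pStarTwist_eq W hp5 hadd hadd').trans hN
  -- §2: the modular assembly (arbitrary `M`)
  obtain ⟨f, hf⟩ := hmod W
  obtain ⟨f', hf'⟩ := hmod (W.quadraticTwist (((-1 : ℤ) ^ (p / 2) * p : ℤ) : ℚ))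
  have h0 := rootNumber_mul_rootNumber_pStarTwist_eq_legendreSym_mul_anyLevel W hp2 hN hpM hN' hf hf'
  -- Kellock–Dokchitser at `p` for both curves, read over `ℤ_p`
  set P : Nat.Primes := ⟨p, hp⟩ with hP
  have hgen : natGenerator ((primesEquiv (R := ℤ)).symm P) = p :=
    congrArg (fun q : Nat.Primes ↦ (q : ℕ)) ((primesEquiv (R := ℤ)).apply_symm_apply P)
  have h23 : ∀ V : WeierstrassCurve ℚ, V.HasAdditiveReductionAt ((primesEquiv (R := ℤ)).symm P) →
      3 < ringChar (ℤ ⧸ ((primesEquiv (R := ℤ)).symm P).asIdeal) := fun _ _ ↦ by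
    rw [Rat.ringChar_int_quotient_asIdeal, hgen]; omega
  have hPN : (P : ℕ) ∣ W.conductorNorm ℤ := by
    change p ∣ _; rw [hN]; exact ⟨M * p, by ring⟩
  have hPN' : (P : ℕ) ∣ (W.quadraticTwist (((-1 : ℤ) ^ (p / 2) * p : ℤ) : ℚ)).conductorNorm ℤ := by
    change p ∣ _; rw [hN']; exact ⟨M * p, by ring⟩
  have hl : atkinLehnerEigenvalueAt f p = ((W.baseChange ℚ_[p]).localRootNumber ℤ_[p] : ℂ) := by
    rw [← localRootNumberAt_primesEquiv_symm_holds W P]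
    exact hF1 hf P hPN (h23 W)
  have hl' : atkinLehnerEigenvalueAt f' p =
      (((W.quadraticTwist (((-1 : ℤ) ^ (p / 2) * p : ℤ) : ℚ)).baseChange ℚ_[p]).localRootNumber ℤ_[p] : ℂ) := by
    rw [← localRootNumberAt_primesEquiv_symm_holds _ P]
    exact hF1' hf' P hPN' (h23 _)
  rw [hl, hl', ← Int.cast_mul, hprod] at h0
  exact_mod_cast h0

end Main

end Summit.BirchSwinnertonDyer.BirchSwinnertonDyer.Theorems.AdditiveKoly.RamifiedHabitat

end
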